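import Summits.Ventures.Crystal3D.Theorems.StickyWulffConstantGenericWallFloorStarPairCoaxial
import Summits.Ventures.Crystal3D.Theorems.StickyWulffConstantGenericWallFloorInPlaneSlots
import HarnessLib

/-!
# `InPlaneTwinStarPair`: the stars-only input pricing the ONE co-axial cross pair of the one-sided core
# (crux `GenericWallFloor`, stmt-Ventures-19480, line `WallLedgerG`)

HONEST FRAMING. Venture `Summits/Ventures/Crystal3D` (cell `crystal3d-full`), helper `--supports` the crux
`GenericWallFloor` of `route-Ventures-StickyWulffConstant`, REGISTERED line `WallLedgerG`, open stub
`stub_twoSlabAdhesion`.  Rung credit only; F-C1 not moved; NOT the crux.  This file states ONE named INPUT (a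
stars-only local statement of exactly the shape of `StarPairCoaxial`, R39d/e) and proves the elementary half of what
the priced ledger `twoSlabAdhesion_stackLedger_cross` (`…StackLedgerCross`) consumes for it.

THE SITUATION.  On a `Σ9` pair `A₂·Λ₀ = R_m R_n (A₁·Λ₀)` with a steep slot `u₁` of grain 1 IN the composition plane
`n` and grain 2's forced ray missing `A₁`'s lattice (its lamella capper lies in `n` too), the only CO-AXIAL pair
(top of a grain-1 stack, top of a grain-2 stack) is the base frame `A₁` (direction `u₁ ⊥ n`) against the lamella frame
`T = R_m A₂` (slot dozen `R_n(A₁·slots)`, direction `d₂ ⊥ n`): mirror twins about `n` with BOTH walk directions in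
the mirror plane (sequel `…Sigma9Cross`).  At a ball `e` where two such walkers end, `e` owns the closed star of `−u₁`
in `A₁` and the closed star of `−d₂` in `T`: ten balls — the shared in-plane hexagon positions around `e` plus ONE
ball above and one below `n` from each star, the `A₁`-star's at `B`-positions, the `T`-star's at `C`-positions.
Compatibility (`1`-separation) forces the two upper (and the two lower) out-of-plane balls to be ANTIPODAL in azimuth,
and then an eleventh unit ball touching `e` would have to sit within `35.3°` of `±n` (off the hexagon) and `≥ 60°` from
both out-of-plane balls on that side, which are `70.5°` apart through the pole: impossible (nearest escape `48.2°`).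
So `deg e ≤ 10`: the double end pays TWO missing contacts, one per walker — exactly what the count
`card_contacts_add_endStates_le_twelve_cross` needs.

* `InPlaneTwinStarPair` — the INPUT (uncertified here): frames `F₁`, `F₂` with `F₂·Λ₀ = (twinFrame F₁ ν)·Λ₀` for a unit
  menu normal `ν` of `F₁`, slots `v₁`, `v₂` with `F₁v₁ ⊥ ν`, `F₂v₂ ⊥ ν`; a `1`-separated `X`, a ball `e` owning both
  closed stars, and an eleventh contact `y` of `e` off both stars ⇒ `False`.  Certifiable by lit's exact stars-only
  machinery (the `StarPairFar` lineage: ≤ 6 relative positions up to symmetry, one of them feasible) and provable by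
  hand along the lines above (not done here).
* `starSet_ne_of_inPlaneTwin` — PROVED: the two closed stars are different point sets (the `F₁`-star contains a ball
  off the plane, at squared distance `8/3 ∉ {0,1,2,3,4}` from every mirrored slot position).

WHAT THIS IS NOT: `InPlaneTwinStarPair` is an input, not a theorem; no walk, no ledger here; F-C1 not moved.
-/

noncomputable section

namespace Summit.Ventures.Crystal3D.Theorems

open Summit.Ventures.Crystal3D Finset
open Literature.MathematicalPhysics.StatisticalMechanics (fccStacking)
open scoped InnerProductSpace

/-- **INPUT `InPlaneTwinStarPair`** (stars-only, shape of `StarPairCoaxial`).  Two frames whose lattices are mirror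
twins about a unit menu normal `ν` of the first (`F₂·Λ₀ = (twinFrame F₁ ν)·Λ₀`), two slots `v₁`, `v₂` whose images
lie IN the mirror plane (`⟪F₁v₁, ν⟫ = ⟪F₂v₂, ν⟫ = 0`); in a `1`-separated configuration a ball `e` OWNING the closed
star of `−v₁` in `F₁` and of `−v₂` in `F₂` (`e + Fᵢ w ∈ X` for `⟪w, vᵢ⟫ < 0`) has NO eleventh contact off the two
stars.  (Numerical content: with the ten star balls present, every unit vector at `e` is within `60°` of a star
direction; nearest escape `48.2°`.) -/
def InPlaneTwinStarPair : Prop :=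
  ∀ (F₁ F₂ : EuclideanSpace ℝ (Fin 3) ≃ₗᵢ[ℝ] EuclideanSpace ℝ (Fin 3)) (ν : EuclideanSpace ℝ (Fin 3)), ‖ν‖ = 1 →
    (∀ w ∈ fccSlots, ⟪F₁ w, ν⟫_ℝ = 0 ∨ ⟪F₁ w, ν⟫_ℝ = Real.sqrt (2 / 3) ∨ ⟪F₁ w, ν⟫_ℝ = -Real.sqrt (2 / 3)) →
    F₂ '' fccStacking 1 (Real.sqrt (2 / 3)) = (twinFrame F₁ ν) '' fccStacking 1 (Real.sqrt (2 / 3)) →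
    ∀ v₁ ∈ fccSlots, ∀ v₂ ∈ fccSlots, ⟪F₁ v₁, ν⟫_ℝ = 0 → ⟪F₂ v₂, ν⟫_ℝ = 0 →
    ∀ (X : Finset (EuclideanSpace ℝ (Fin 3))), (∀ p ∈ X, ∀ q ∈ X, p ≠ q → 1 ≤ dist p q) →
    ∀ e ∈ X, (∀ w ∈ fccSlots, ⟪w, v₁⟫_ℝ < 0 → e + F₁ w ∈ X) → (∀ w ∈ fccSlots, ⟪w, v₂⟫_ℝ < 0 → e + F₂ w ∈ X) →
    ∀ y ∈ X, dist e y = 1 →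
      (∀ w ∈ fccSlots, ⟪w, v₁⟫_ℝ < 0 → y ≠ e + F₁ w) → (∀ w ∈ fccSlots, ⟪w, v₂⟫_ℝ < 0 → y ≠ e + F₂ w) → False

/-- Under `InPlaneTwinStarPair`, the two owned stars COVER the contacts of `e` (the covering form consumed by
`card_contacts_add_endStates_le_twelve_cross`). -/
theorem cover_of_inPlaneTwinStarPair (h : InPlaneTwinStarPair) {X : Finset (EuclideanSpace ℝ (Fin 3))}
    (hX : ∀ p ∈ X, ∀ q ∈ X, p ≠ q → 1 ≤ dist p q)
    {F₁ F₂ : EuclideanSpace ℝ (Fin 3) ≃ₗᵢ[ℝ] EuclideanSpace ℝ (Fin 3)} {ν v₁ v₂ : EuclideanSpace ℝ (Fin 3)}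
    (hν : ‖ν‖ = 1)
    (hmenu : ∀ w ∈ fccSlots, ⟪F₁ w, ν⟫_ℝ = 0 ∨ ⟪F₁ w, ν⟫_ℝ = Real.sqrt (2 / 3) ∨ ⟪F₁ w, ν⟫_ℝ = -Real.sqrt (2 / 3))
    (htwin : F₂ '' fccStacking 1 (Real.sqrt (2 / 3)) = (twinFrame F₁ ν) '' fccStacking 1 (Real.sqrt (2 / 3)))
    (hv₁ : v₁ ∈ fccSlots) (hv₂ : v₂ ∈ fccSlots) (hv₁ν : ⟪F₁ v₁, ν⟫_ℝ = 0) (hv₂ν : ⟪F₂ v₂, ν⟫_ℝ = 0)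
    {e : EuclideanSpace ℝ (Fin 3)} (he : e ∈ X)
    (hown₁ : ∀ w ∈ fccSlots, ⟪w, v₁⟫_ℝ < 0 → e + F₁ w ∈ X) (hown₂ : ∀ w ∈ fccSlots, ⟪w, v₂⟫_ℝ < 0 → e + F₂ w ∈ X) :
    ∀ q ∈ X, dist e q = 1 → q ∈ starSet e F₁ v₁ ∪ starSet e F₂ v₂ := by
  intro q hq hdq
  by_contra hnot
  rw [Finset.mem_union, not_or] at hnot
  have hoff₁ : ∀ w ∈ fccSlots, ⟪w, v₁⟫_ℝ < 0 → q ≠ e + F₁ w := fun w hw hlt hEq =>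
    hnot.1 (mem_starSet_iff.2 ⟨w, hw, hlt, hEq⟩)
  have hoff₂ : ∀ w ∈ fccSlots, ⟪w, v₂⟫_ℝ < 0 → q ≠ e + F₂ w := fun w hw hlt hEq =>
    hnot.2 (mem_starSet_iff.2 ⟨w, hw, hlt, hEq⟩)
  exact h F₁ F₂ ν hν hmenu htwin v₁ hv₁ v₂ hv₂ hv₁ν hv₂ν X hX e he hown₁ hown₂ q hq hdq hoff₁ hoff₂

/-- A slot IN a mirror plane has a near-polar slot in its closed star: for a unit menu normal `ν` of `F` and a slot
`v` with `⟪F v, ν⟫ = 0` there is a slot `b` with `⟪b, v⟫ < 0` and `⟪F b, ν⟫ = −√(2/3)` (`v = a − b` for two of the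
three near-polar slots, `inPlane_eq_sub_of_nearPolar`). -/
theorem exists_star_slot_off_plane (F : EuclideanSpace ℝ (Fin 3) ≃ₗᵢ[ℝ] EuclideanSpace ℝ (Fin 3))
    {ν v : EuclideanSpace ℝ (Fin 3)} (hν : ‖ν‖ = 1)
    (hmenu : ∀ w ∈ fccSlots, ⟪F w, ν⟫_ℝ = 0 ∨ ⟪F w, ν⟫_ℝ = Real.sqrt (2 / 3) ∨ ⟪F w, ν⟫_ℝ = -Real.sqrt (2 / 3))
    (hv : v ∈ fccSlots) (hvν : ⟪F v, ν⟫_ℝ = 0) :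
    ∃ b ∈ fccSlots, ⟪b, v⟫_ℝ < 0 ∧ ⟪F b, ν⟫_ℝ = -Real.sqrt (2 / 3) := by
  classical
  have hmν : ‖-ν‖ = 1 := by rw [norm_neg, hν]
  have hmenu' : ∀ w ∈ fccSlots, ⟪F w, -ν⟫_ℝ = 0 ∨ ⟪F w, -ν⟫_ℝ = Real.sqrt (2 / 3) ∨ ⟪F w, -ν⟫_ℝ = -Real.sqrt (2 / 3) := by
    intro w hw
    rw [inner_neg_right]
    rcases hmenu w hw with h | h | h
    · exact Or.inl (by rw [h, neg_zero])
    · exact Or.inr (Or.inr (by rw [h]))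
    · exact Or.inr (Or.inl (by rw [h, neg_neg]))
  obtain ⟨w₁, hw₁, w₂, hw₂, w₃, hw₃, h12, h13, h23, hn₁, hn₂, hn₃⟩ := exists_three_far_slots F hmν hmenu'
  rw [inner_neg_right, neg_eq_iff_eq_neg] at hn₁ hn₂ hn₃
  obtain ⟨a, ha, b, hb, hab⟩ := inPlane_eq_sub_of_nearPolar F hν hmenu hv hvν hw₁ hw₂ hw₃ h12 h13 h23 hn₁ hn₂ hn₃
  have hbslot : b ∈ fccSlots := by
    simp only [Finset.mem_insert, Finset.mem_singleton] at hb
    rcases hb with rfl | rfl | rfl <;> assumption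
  have haslot : a ∈ fccSlots := by
    simp only [Finset.mem_insert, Finset.mem_singleton] at ha
    rcases ha with rfl | rfl | rfl <;> assumption
  have hbν : ⟪F b, ν⟫_ℝ = -Real.sqrt (2 / 3) := by
    simp only [Finset.mem_insert, Finset.mem_singleton] at hb
    rcases hb with rfl | rfl | rfl
    · exact hn₁
    · exact hn₂
    · exact hn₃
  refine ⟨b, hbslot, ?_, hbν⟩
  -- `⟪b, v⟫ = ⟪b, a⟫ − 1 < 0` unless `a = b`, which would make `v = 0`
  have hb1 : ‖b‖ = 1 := norm_eq_one_of_mem_fccSlots hbslot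
  have ha1 : ‖a‖ = 1 := norm_eq_one_of_mem_fccSlots haslot
  have hbb : ⟪b, b⟫_ℝ = 1 := by rw [real_inner_self_eq_norm_sq, hb1, one_pow]
  rw [hab, inner_sub_right, hbb]
  have hle : ⟪b, a⟫_ℝ ≤ 1 := by
    have := real_inner_le_norm b a; rw [hb1, ha1, one_mul] at this; exact this
  rcases hle.lt_or_eq with hlt | heq
  · linarith
  · exfalso
    have hba : b = a := by
      have h0 : ‖b - a‖ ^ 2 = 0 := by rw [norm_sub_sq_real, hb1, ha1, heq]; ring
      rw [sq_eq_zero_iff, norm_eq_zero, sub_eq_zero] at h0; exact h0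
    have hv1 := norm_eq_one_of_mem_fccSlots hv
    rw [hab, hba, sub_self, norm_zero] at hv1
    exact zero_ne_one hv1

/-- **The two in-plane twin stars are different point sets.**  For `F₂·Λ₀ = (twinFrame F₁ ν)·Λ₀` (`ν` a unit menu
normal of `F₁`) and a slot `v₁` with `F₁v₁ ⊥ ν`: `starSet e F₁ v₁ ≠ starSet e F₂ v₂` for every slot `v₂` (the
`F₁`-star has a ball off the plane; a mirrored slot position at the same point would be a slot at squared distance
`8/3` from it). -/
theorem starSet_ne_of_inPlaneTwin {F₁ F₂ : EuclideanSpace ℝ (Fin 3) ≃ₗᵢ[ℝ] EuclideanSpace ℝ (Fin 3)}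
    {ν v₁ v₂ e : EuclideanSpace ℝ (Fin 3)} (hν : ‖ν‖ = 1)
    (hmenu : ∀ w ∈ fccSlots, ⟪F₁ w, ν⟫_ℝ = 0 ∨ ⟪F₁ w, ν⟫_ℝ = Real.sqrt (2 / 3) ∨ ⟪F₁ w, ν⟫_ℝ = -Real.sqrt (2 / 3))
    (htwin : F₂ '' fccStacking 1 (Real.sqrt (2 / 3)) = (twinFrame F₁ ν) '' fccStacking 1 (Real.sqrt (2 / 3)))
    (hv₁ : v₁ ∈ fccSlots) (hv₁ν : ⟪F₁ v₁, ν⟫_ℝ = 0) :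
    starSet e F₁ v₁ ≠ starSet e F₂ v₂ := by
  classical
  intro hEq
  have hr : 0 < Real.sqrt (2 / 3) := Real.sqrt_pos.2 (by norm_num)
  have h23 : Real.sqrt (2 / 3) ^ 2 = 2 / 3 := Real.sq_sqrt (by norm_num)
  obtain ⟨b, hb, hbv, hbν⟩ := exists_star_slot_off_plane F₁ hν hmenu hv₁ hv₁ν
  -- `e + F₁ b` is in the first star, hence in the second: `F₁ b = F₂ w'` for a slot `w'`
  have hmem : e + F₁ b ∈ starSet e F₂ v₂ := by rw [← hEq]; exact mem_starSet_iff.2 ⟨b, hb, hbv, rfl⟩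
  obtain ⟨w', hw', -, hEq'⟩ := mem_starSet_iff.1 hmem
  have hFb : F₁ b = F₂ w' := add_left_cancel hEq'
  -- so `F₁ b` is a mirrored slot: `F₁ b = F₁ c − 2⟪F₁ c, ν⟫ ν`
  have hslots := image_fccSlots_eq_of_image_fcc_eq _ _ htwin
  have hmemS : F₁ b ∈ (twinFrame F₁ ν : EuclideanSpace ℝ (Fin 3) → EuclideanSpace ℝ (Fin 3)) '' ↑fccSlots := by
    rw [← hslots]; exact ⟨w', Finset.mem_coe.2 hw', hFb.symm⟩
  obtain ⟨c, hc, hcb⟩ := hmemS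
  rw [Finset.mem_coe] at hc
  rw [twinFrame_apply F₁ hν] at hcb
  -- compare `ν`-components and lengths
  rcases hmenu c hc with h0 | hp | hm
  · rw [h0, mul_zero, zero_smul, sub_zero] at hcb
    rw [← hcb, h0] at hbν; linarith
  all_goals
    have hdiff : F₁ b - F₁ c = -(2 * ⟪F₁ c, ν⟫_ℝ) • ν := by rw [← hcb]; module
    have hnorm : ‖b - c‖ ^ 2 = 8 / 3 := by
      rw [← LinearIsometryEquiv.norm_map F₁, map_sub, hdiff, norm_smul, Real.norm_eq_abs, hν, mul_one, sq_abs]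
      first | rw [hp] | rw [hm]
      nlinarith [h23]
    have hb1 := norm_eq_one_of_mem_fccSlots hb
    have hc1 := norm_eq_one_of_mem_fccSlots hc
    have hexp : ‖b - c‖ ^ 2 = 2 - 2 * ⟪b, c⟫_ℝ := by rw [norm_sub_sq_real, hb1, hc1]; ring
    rcases inner_slots_mem hb hc with h | h | h | h | h <;> rw [hexp, h] at hnorm <;> norm_num at hnorm

end Summit.Ventures.Crystal3D.Theorems

end
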